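import Summits.BirchSwinnertonDyer.BirchSwinnertonDyer.Theses.ThetaPartnerAtTwo
import Summits.BirchSwinnertonDyer.BirchSwinnertonDyer.Theorems.ThetaPartnerAtTwoSignedTransportAtTwoBridgeNonPrimitive
import Summits.BirchSwinnertonDyer.BirchSwinnertonDyer.Theorems.ThetaPartnerAtTwoSignedTransportAtTwoCongruenceAlgebra
import HarnessLib

/-!
# Crux `SignedTransportAtTwo` (stmt-BirchSwinnertonDyer-20333, route `ThetaPartnerAtTwo`): the analytic binder driven
# UPSTREAM — one congruence modulo `2Λ` (up to a `2`-adic unit) between the Néron-normalised NON-PRIMITIVE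
# `♭`-functions of `W` and of its CM partner `A` implies the local-term-free `μ`/`λ` transfer `V2np`
# (lead prover bsd-wall-tp2-p1 g2; `--supports stmt-BirchSwinnertonDyer-20333`; closes nothing)

HONEST FRAMING. THEOREMS ONLY; every research input is an explicit hypothesis spelled inline; nothing about any curve is
asserted; BSD is not proved by any of this. Fourth composition of the line `bridge` (after `…BridgeGV.lean` §1–§2 and
`…BridgeNonPrimitive.lean` §2).

WHY THIS SHAPE. In Greenberg–Vatsal (Invent. Math. 142 (2000)) the analytic transfer of `μ = 0` and of `λ` between two
`p`-congruent curves is not primitive: it is READ OFF one congruence of power series — Thm. (1.6)/§3 with Vatsal's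
canonical periods (Vatsal, Duke Math. J. 98 (1999), Thm. (1.10)): the non-primitive `p`-adic `L`-functions satisfy
`L_{Σ₀}(E₁, T) ≡ u · L_{Σ₀}(E₂, T) (mod pΛ)` for a `p`-adic unit `u`, whence (GV p. 9, EPW Thm. 1) `μ = 0` passes from
one side to the other and the `λ`-invariants of the non-primitive functions coincide. That passage is `Λ`-algebra, for any prime `p` (route-independent file
`Theorems/ThetaPartnerAtTwoSignedTransportAtTwoCongruenceAlgebra.lean`, `ne_zero_mu_lam_of_congr`): if `p^{m'}·F ≡ u·p^{m}·F_A (mod p^{m+m'+1})` and `μ(F_A) = m'`, then `μ(F) = m` and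
`λ(F) = λ(F_A)` (write `F_A = p^{m'}·F_A⁰` with `F_A⁰ ≢ 0 (mod p)`; cancel `p^{m'}`; reduce mod `p`). §2 (numbering kept) reads it at `p = 2`
on the objects of the registered analytic stub `stub_V2np` of the skeleton `bridge` v4: the binder `hV2cong` — for
integral multiples `G`, `G_A` of the Néron-normalised `♭`-functions (`ι G = 2^m ϖ ι L♭_W`, `ι G_A = 2^{m′} ϖ_A ι L♭_A`) and an
admissible `S₀`, `2^{m′}·G·∏_{S₀}𝒫(W) ≡ u·2^{m}·G_A·∏_{S₀}𝒫(A) (mod 2^{m+m′+1}Λ)` for some `u ∈ ℤ₂ˣ`, i.e.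
"`ϖ L♭_{W,S₀} ≡ u ϖ_A L♭_{A,S₀} (mod 2)`" — implies the `V2np` binder verbatim (`v2np_of_v2cong`), and §3 composes with
the landed `signedTransportAtTwo_of_gvBinders_nonPrimitive` (p520200): Kμ2′ + Kλ2 + V2cong ⇒ the crux BY NAME.
V2cong is the GV (1.6) / Vatsal (1.10) congruence READ AT `2` for Pollack's `♭`-function in the Néron normalisation —
unpublished at `p = 2` (and, for the signed functions, at any `p`: Pollack–Weston 2011 attribute the supersingular
analogue to the unpublished [GIP]); it is a research hypothesis here, not a fact. No sorry; standard axioms.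

References: [GreenbergVatsal2000] Thm. (1.6), §1 pp. 8–9, §3; [Vatsal1999] Thm. (1.10); [EmertonPollackWeston2006]
Thm. 1; [Washington1997] §7.1, §13.1.
-/

set_option autoImplicit false
-- D-0017: single-problem summit, so `Summit.BirchSwinnertonDyer.BirchSwinnertonDyer.…` repeats a namespace BY DESIGN.
set_option linter.dupNamespace false

noncomputable section

open scoped Classical MatrixGroups ModularForm BigOperators

open CongruenceSubgroup WeierstrassCurve NumberField IsDedekindDomain Rat.HeightOneSpectrum
  Literature Literature.NumberTheory.EllipticCurves
  Literature.NumberTheory.EllipticCurves.ModularForms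
  Literature.NumberTheory.EllipticCurves.Rank1Residual
  Literature.NumberTheory.EllipticCurves.Kobayashi2003 ZpExtension
  Literature.NumberTheory.EllipticCurves.GreenbergVatsal2000
  Summit.BirchSwinnertonDyer.Rank1Residual.X1.MuLambda
  Summit.BirchSwinnertonDyer.Rank1Residual.Supersingular
  Summit.BirchSwinnertonDyer.Rank1Residual.X2.EulerFactorInvariants
  Summit.BirchSwinnertonDyer.BirchSwinnertonDyer.Theorems.TwoAdicTwistConverse

namespace Summit.BirchSwinnertonDyer.BirchSwinnertonDyer.Theorems.SignedTransportAtTwo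

/-! ## §2. `p = 2`: the congruence binder `V2cong` implies the local-term-free transfer binder `V2np` -/

/-- **V2cong ⇒ V2np.** If, for integral multiples `G`, `G_A` of the Néron-normalised `♭`-functions of `W` and `A`
(`ι G = 2^m ϖ ι L♭_W`, `ι G_A = 2^{m'} ϖ_A ι L♭_A`) and an admissible `S₀`, the non-primitive functions satisfy ONE
congruence `2^{m'}·G·∏_{S₀}𝒫(W) ≡ u·2^{m}·G_A·∏_{S₀}𝒫(A) (mod 2^{m+m'+1}Λ)`, `u ∈ ℤ₂ˣ` (GV Thm. (1.6) / Vatsal (1.10) shape,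
READ AT `2`), then `μ(G_A·∏𝒫(A)) = m'` forces `μ(G·∏𝒫(W)) = m` and `λ(G·∏𝒫(W)) = λ(G_A·∏𝒫(A))` — the registered
analytic stub `stub_V2np` of line `bridge` v4, verbatim. Pure `Λ`-algebra (`ne_zero_mu_lam_of_congr`) plus `G_A·∏𝒫(A) ≠ 0`
(`C_mul_iota_ne_zero`, `eulerFactorProduct_two_ne_zero_mu_lam`).
[cite: GreenbergVatsal2000, Thm. (1.6) and §1 p. 9] [cite: Vatsal1999, Thm. (1.10)] [cite: EmertonPollackWeston2006, Thm. 1] -/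
theorem v2np_of_v2cong
    (hV2cong :
    ∀ (W : WeierstrassCurve ℚ) [W.IsElliptic] [W.IsGloballyMinimal] (A : WeierstrassCurve ℚ) [A.IsElliptic]
      [A.IsGloballyMinimal], ¬ W.HasCM → W.analyticRank = 0 → GoodSS W 2 → W.frobeniusTrace 2 = 0 →
      A.HasCM → GoodSS A 2 → A.frobeniusTrace 2 = 0 →
    (∃ e : WeierstrassCurve.geomTorsion W (2 : ℤ) ≃+ WeierstrassCurve.geomTorsion A (2 : ℤ),
      ∀ (σ : Field.absoluteGaloisGroup ℚ) (P : WeierstrassCurve.geomTorsion W (2 : ℤ)), e (σ • P) = σ • e P) →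
    ∀ (γ : Field.absoluteGaloisGroup ℚ), IsCyclotomicVariable 2 γ →
    ∀ [NeZero (W.conductorNorm ℤ)] (f : CuspForm (Gamma0 (W.conductorNorm ℤ)) 2), IsNewformOf W f →
    ∀ (ϖ : ℚ), (ϖ : ℝ) * W.realPeriodRat = plusPeriod f →
    ∀ (Lplus Lminus : IwasawaAlgebra 2), IsPollackPair f 2 Lplus Lminus →
    ∀ [NeZero (A.conductorNorm ℤ)] (fA : CuspForm (Gamma0 (A.conductorNorm ℤ)) 2), IsNewformOf A fA →
    ∀ (ϖA : ℚ), (ϖA : ℝ) * A.realPeriodRat = plusPeriod fA →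
    ∀ (LplusA LminusA : IwasawaAlgebra 2), IsPollackPair fA 2 LplusA LminusA →
    ∀ (S₀ : Finset (HeightOneSpectrum (𝓞 ℚ))), (∀ v ∈ S₀, ((2 : ℕ) : 𝓞 ℚ) ∉ v.asIdeal) →
      (∀ v : HeightOneSpectrum (𝓞 ℚ), ¬ W.HasGoodReductionAt v → v ∈ S₀) →
      (∀ v : HeightOneSpectrum (𝓞 ℚ), ¬ A.HasGoodReductionAt v → v ∈ S₀) →
    ∀ (G : IwasawaAlgebra 2) (m : ℕ), iwasawaToPowerSeries 2 G =
        PowerSeries.C ((2 : ℚ_[2]) ^ m * (ϖ : ℚ_[2])) * iwasawaToPowerSeries 2 (kobayashiL 1 Lplus Lminus) →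
    ∀ (GA : IwasawaAlgebra 2) (m' : ℕ), iwasawaToPowerSeries 2 GA =
        PowerSeries.C ((2 : ℚ_[2]) ^ m' * (ϖA : ℚ_[2])) * iwasawaToPowerSeries 2 (kobayashiL 1 LplusA LminusA) →
    ∃ u : ℤ_[2]ˣ, PowerSeries.C ((2 : ℤ_[2]) ^ (m + m' + 1)) ∣
      PowerSeries.C ((2 : ℤ_[2]) ^ m') * (G * eulerFactorProduct W 2 S₀) -
        PowerSeries.C ((u : ℤ_[2]) * (2 : ℤ_[2]) ^ m) * (GA * eulerFactorProduct A 2 S₀)) :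
    ∀ (W : WeierstrassCurve ℚ) [W.IsElliptic] [W.IsGloballyMinimal] (A : WeierstrassCurve ℚ) [A.IsElliptic]
      [A.IsGloballyMinimal], ¬ W.HasCM → W.analyticRank = 0 → GoodSS W 2 → W.frobeniusTrace 2 = 0 →
      A.HasCM → GoodSS A 2 → A.frobeniusTrace 2 = 0 →
    (∃ e : WeierstrassCurve.geomTorsion W (2 : ℤ) ≃+ WeierstrassCurve.geomTorsion A (2 : ℤ),
      ∀ (σ : Field.absoluteGaloisGroup ℚ) (P : WeierstrassCurve.geomTorsion W (2 : ℤ)), e (σ • P) = σ • e P) →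
    ∀ (γ : Field.absoluteGaloisGroup ℚ), IsCyclotomicVariable 2 γ →
    ∀ [NeZero (W.conductorNorm ℤ)] (f : CuspForm (Gamma0 (W.conductorNorm ℤ)) 2), IsNewformOf W f →
    ∀ (ϖ : ℚ), (ϖ : ℝ) * W.realPeriodRat = plusPeriod f →
    ∀ (Lplus Lminus : IwasawaAlgebra 2), IsPollackPair f 2 Lplus Lminus →
    ∀ [NeZero (A.conductorNorm ℤ)] (fA : CuspForm (Gamma0 (A.conductorNorm ℤ)) 2), IsNewformOf A fA →
    ∀ (ϖA : ℚ), (ϖA : ℝ) * A.realPeriodRat = plusPeriod fA →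
    ∀ (LplusA LminusA : IwasawaAlgebra 2), IsPollackPair fA 2 LplusA LminusA →
    ∀ (S₀ : Finset (HeightOneSpectrum (𝓞 ℚ))), (∀ v ∈ S₀, ((2 : ℕ) : 𝓞 ℚ) ∉ v.asIdeal) →
      (∀ v : HeightOneSpectrum (𝓞 ℚ), ¬ W.HasGoodReductionAt v → v ∈ S₀) →
      (∀ v : HeightOneSpectrum (𝓞 ℚ), ¬ A.HasGoodReductionAt v → v ∈ S₀) →
    ∀ (G : IwasawaAlgebra 2) (m : ℕ), iwasawaToPowerSeries 2 G =
        PowerSeries.C ((2 : ℚ_[2]) ^ m * (ϖ : ℚ_[2])) * iwasawaToPowerSeries 2 (kobayashiL 1 Lplus Lminus) →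
    ∀ (GA : IwasawaAlgebra 2) (m' : ℕ), iwasawaToPowerSeries 2 GA =
        PowerSeries.C ((2 : ℚ_[2]) ^ m' * (ϖA : ℚ_[2])) * iwasawaToPowerSeries 2 (kobayashiL 1 LplusA LminusA) →
    mu (GA * eulerFactorProduct A 2 S₀) = m' →
      mu (G * eulerFactorProduct W 2 S₀) = m ∧
        lam (G * eulerFactorProduct W 2 S₀) = lam (GA * eulerFactorProduct A 2 S₀) := by
  intro W _ _ A _ _ hcm hr hss ha hAcm hAss hAa hiso γ hcv _ f hf ϖ hϖ Lplus Lminus hPP _ fA hfA ϖA hϖA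
    LplusA LminusA hPPA S₀ hS₀2 hS₀W hS₀A G m hG GA m' hGA hμA
  obtain ⟨u, hu⟩ := hV2cong W A hcm hr hss ha hAcm hAss hAa hiso γ hcv f hf ϖ hϖ Lplus Lminus hPP fA hfA ϖA hϖA
    LplusA LminusA hPPA S₀ hS₀2 hS₀W hS₀A G m hG GA m' hGA
  -- `G_A · ∏𝒫(A) ≠ 0`
  have hGA0 : GA ≠ 0 := by
    intro h0
    apply C_pow_mul_ne_zero m' (C_mul_iota_ne_zero hfA hϖA hPPA)
    rw [← hGA, h0, map_zero]
  have hFA0 : GA * eulerFactorProduct A 2 S₀ ≠ 0 := (mu_lam_mul_eulerFactorProduct_two A S₀ hS₀2 hGA0).1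
  -- the Λ-algebra at `p = 2`
  have h2 : ((2 : ℕ) : ℤ_[2]) = (2 : ℤ_[2]) := by norm_num
  have hcong : PowerSeries.C (((2 : ℕ) : ℤ_[2]) ^ (m + m' + 1)) ∣
      PowerSeries.C (((2 : ℕ) : ℤ_[2]) ^ m') * (G * eulerFactorProduct W 2 S₀) -
        PowerSeries.C ((u : ℤ_[2]) * ((2 : ℕ) : ℤ_[2]) ^ m) * (GA * eulerFactorProduct A 2 S₀) := by
    rw [h2]; exact hu
  obtain ⟨-, hμ, hlam⟩ := ne_zero_mu_lam_of_congr u hFA0 hμA hcong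
  exact ⟨hμ, hlam⟩

/-! ## §3. The composition: Kμ2′ + Kλ2 + V2cong ⇒ the crux BY NAME -/

/-- **The crux `SignedTransportAtTwo` BY NAME from Kμ2′ (`hmuT`), Kλ2 at `2` (`hlam2`) and the congruence binder
V2cong (`hV2cong`)** — `signedTransportAtTwo_of_gvBinders_nonPrimitive` (p520200) fed with `v2np_of_v2cong hV2cong`.
Nothing asserted beyond the binders.
[cite: GreenbergVatsal2000, Thm. (1.4), Thm. (1.6) and Prop. (2.4)] [cite: BDKim2009, Cor. 2.13 (pp. 185–187)]
[cite: Vatsal1999, Thm. (1.10)] [cite: Kobayashi2003, Conjecture (p. 2)] -/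
theorem signedTransportAtTwo_of_gvBinders_congruence
    (hmuT :
    ∀ (W : WeierstrassCurve ℚ) [W.IsElliptic] [W.IsGloballyMinimal] (A : WeierstrassCurve ℚ) [A.IsElliptic]
      [A.IsGloballyMinimal], ¬ W.HasCM → W.analyticRank = 0 → GoodSS W 2 → W.frobeniusTrace 2 = 0 →
      A.HasCM → GoodSS A 2 → A.frobeniusTrace 2 = 0 →
    (∃ e : WeierstrassCurve.geomTorsion W (2 : ℤ) ≃+ WeierstrassCurve.geomTorsion A (2 : ℤ),
      ∀ (σ : Field.absoluteGaloisGroup ℚ) (P : WeierstrassCurve.geomTorsion W (2 : ℤ)), e (σ • P) = σ • e P) →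
    ∀ (κ : ZpExtension ℚ 2) (γ : Field.absoluteGaloisGroup ℚ), κ.IsCyclotomic → κ.IsTopGenerator γ →
    ∀ (D : SignedSelmerDualData W κ γ 1) (D' : SignedSelmerDualData A κ γ 1)
      [Module.Finite (IwasawaAlgebra 2) D.X] [Module.Finite (IwasawaAlgebra 2) D'.X],
      Module.IsTorsion (IwasawaAlgebra 2) D'.X → D'.mu = 0 →
      Module.IsTorsion (IwasawaAlgebra 2) D.X ∧ D.mu = 0)
    (hlam2 :
    ∀ (W : WeierstrassCurve ℚ) [W.IsElliptic] [W.IsGloballyMinimal] (A : WeierstrassCurve ℚ) [A.IsElliptic]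
      [A.IsGloballyMinimal], ¬ W.HasCM → W.analyticRank = 0 → GoodSS W 2 → W.frobeniusTrace 2 = 0 →
      A.HasCM → GoodSS A 2 → A.frobeniusTrace 2 = 0 →
    (∃ e : WeierstrassCurve.geomTorsion W (2 : ℤ) ≃+ WeierstrassCurve.geomTorsion A (2 : ℤ),
      ∀ (σ : Field.absoluteGaloisGroup ℚ) (P : WeierstrassCurve.geomTorsion W (2 : ℤ)), e (σ • P) = σ • e P) →
    ∀ (κ : ZpExtension ℚ 2) (γ : Field.absoluteGaloisGroup ℚ), κ.IsCyclotomic → κ.IsTopGenerator γ →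
    ∀ (S₀ : Finset (HeightOneSpectrum (𝓞 ℚ))), (∀ v ∈ S₀, ((2 : ℕ) : 𝓞 ℚ) ∉ v.asIdeal) →
      (∀ v : HeightOneSpectrum (𝓞 ℚ), ¬ W.HasGoodReductionAt v → v ∈ S₀) →
      (∀ v : HeightOneSpectrum (𝓞 ℚ), ¬ A.HasGoodReductionAt v → v ∈ S₀) →
    ∀ (D : SignedSelmerDualData W κ γ 1) (D' : SignedSelmerDualData A κ γ 1)
      [Module.Finite (IwasawaAlgebra 2) D.X] [Module.Finite (IwasawaAlgebra 2) D'.X],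
      Module.IsTorsion (IwasawaAlgebra 2) D.X → Module.IsTorsion (IwasawaAlgebra 2) D'.X → D.mu = 0 → D'.mu = 0 →
      lambdaInvariant 2 D.X +
          ∑ v ∈ S₀, 2 ^ padicValNat 2 ((Rat.HeightOneSpectrum.natGenerator v ^ 2 - 1) / 8) * dMultiplicity W 2 v =
        lambdaInvariant 2 D'.X +
          ∑ v ∈ S₀, 2 ^ padicValNat 2 ((Rat.HeightOneSpectrum.natGenerator v ^ 2 - 1) / 8) * dMultiplicity A 2 v)
    (hV2cong :
    ∀ (W : WeierstrassCurve ℚ) [W.IsElliptic] [W.IsGloballyMinimal] (A : WeierstrassCurve ℚ) [A.IsElliptic]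
      [A.IsGloballyMinimal], ¬ W.HasCM → W.analyticRank = 0 → GoodSS W 2 → W.frobeniusTrace 2 = 0 →
      A.HasCM → GoodSS A 2 → A.frobeniusTrace 2 = 0 →
    (∃ e : WeierstrassCurve.geomTorsion W (2 : ℤ) ≃+ WeierstrassCurve.geomTorsion A (2 : ℤ),
      ∀ (σ : Field.absoluteGaloisGroup ℚ) (P : WeierstrassCurve.geomTorsion W (2 : ℤ)), e (σ • P) = σ • e P) →
    ∀ (γ : Field.absoluteGaloisGroup ℚ), IsCyclotomicVariable 2 γ →
    ∀ [NeZero (W.conductorNorm ℤ)] (f : CuspForm (Gamma0 (W.conductorNorm ℤ)) 2), IsNewformOf W f →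
    ∀ (ϖ : ℚ), (ϖ : ℝ) * W.realPeriodRat = plusPeriod f →
    ∀ (Lplus Lminus : IwasawaAlgebra 2), IsPollackPair f 2 Lplus Lminus →
    ∀ [NeZero (A.conductorNorm ℤ)] (fA : CuspForm (Gamma0 (A.conductorNorm ℤ)) 2), IsNewformOf A fA →
    ∀ (ϖA : ℚ), (ϖA : ℝ) * A.realPeriodRat = plusPeriod fA →
    ∀ (LplusA LminusA : IwasawaAlgebra 2), IsPollackPair fA 2 LplusA LminusA →
    ∀ (S₀ : Finset (HeightOneSpectrum (𝓞 ℚ))), (∀ v ∈ S₀, ((2 : ℕ) : 𝓞 ℚ) ∉ v.asIdeal) →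
      (∀ v : HeightOneSpectrum (𝓞 ℚ), ¬ W.HasGoodReductionAt v → v ∈ S₀) →
      (∀ v : HeightOneSpectrum (𝓞 ℚ), ¬ A.HasGoodReductionAt v → v ∈ S₀) →
    ∀ (G : IwasawaAlgebra 2) (m : ℕ), iwasawaToPowerSeries 2 G =
        PowerSeries.C ((2 : ℚ_[2]) ^ m * (ϖ : ℚ_[2])) * iwasawaToPowerSeries 2 (kobayashiL 1 Lplus Lminus) →
    ∀ (GA : IwasawaAlgebra 2) (m' : ℕ), iwasawaToPowerSeries 2 GA =
        PowerSeries.C ((2 : ℚ_[2]) ^ m' * (ϖA : ℚ_[2])) * iwasawaToPowerSeries 2 (kobayashiL 1 LplusA LminusA) →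
    ∃ u : ℤ_[2]ˣ, PowerSeries.C ((2 : ℤ_[2]) ^ (m + m' + 1)) ∣
      PowerSeries.C ((2 : ℤ_[2]) ^ m') * (G * eulerFactorProduct W 2 S₀) -
        PowerSeries.C ((u : ℤ_[2]) * (2 : ℤ_[2]) ^ m) * (GA * eulerFactorProduct A 2 S₀)) :
    Summit.BirchSwinnertonDyer.BirchSwinnertonDyer.Theses.ThetaPartnerAtTwo.SignedTransportAtTwo :=
  signedTransportAtTwo_of_gvBinders_nonPrimitive hmuT hlam2 (v2np_of_v2cong hV2cong)

end Summit.BirchSwinnertonDyer.BirchSwinnertonDyer.Theorems.SignedTransportAtTwo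

end
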